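import Summits.HubbardSuperconductivity.HubbardSuperconductivity.Theorems.BirComplexStableXY.Negative.WitnessTable
import Literature.MathematicalPhysics.QuantumFieldTheory.TphiSeminorm
import Mathlib.Analysis.SpecialFunctions.ExpDeriv
import HarnessLib

/-!
# Route `BalabanIR`, crux `BirComplexStableXYR` (item `stmt-HubbardSuperconductivity-14845`),
# line `fat-gaussian-defect-calculus`: stub G3 `stub_tphiSeminorm_genF_le`

Helper (`--supports`) for the crux
`Summit.HubbardSuperconductivity.HubbardSuperconductivity.Theses.BalabanIR.BirComplexStableXYR`,
line `fat-gaussian-defect-calculus` (lead skeleton `Cruxes/BirComplexStableXYR/Lines/fat_gaussian_defect_calculus.lean`),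
stub G3 `stub_tphiSeminorm_genF_le`: **hypothesis (A) is the `T_φ(1)` bound of the window weight.**

**Statement.** Assume the character bound (stub G2, taken as the hypothesis `hchar`): for every frequency
`n : Freq r`, every Taylor order `N`, every `𝔥 ≥ 0` and every point `u`, the window character
`χ_n : φ ↦ exp(i·Σ_w n_w φ_w)` has `‖χ_n‖_{T_φ(𝔥),u} ≤ e^{𝔥·Σ_w|n_w|}`.  Then for every table `c : Table r`,
every `N`, every `0 ≤ 𝔥 ≤ 1` and every `u`:
`‖genF c‖_{T_φ(𝔥),u} ≤ normA c = Σ_n ‖c_n‖ e^{Σ_w |n_w|}`.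

**Proof.** `genF c = Σ_{n ∈ supp c} c_n · χ_n` as functions of `φ` (unfold `Finsupp.sum`).  By induction over
the finite support, with the triangle inequality `tphiSeminorm_add_le` (every summand is smooth: `χ_n` is
`Complex.exp` of a linear form), the product property `tphiSeminorm_mul_le` applied to the constant `c_n`
(`tphiSeminorm_const`: its seminorm is `‖c_n‖`) times `χ_n`, the hypothesis `hchar`, and the monotonicity
`e^{𝔥|n|₁} ≤ e^{|n|₁}` for `𝔥 ≤ 1`, one gets
`‖Σ_{n∈s} c_n χ_n‖_{T_φ(𝔥),u} ≤ Σ_{n∈s} ‖c_n‖ e^{|n|₁}` for every finset `s`; at `s = supp c` the right-hand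
side is `normA c` (unfold `Finsupp.sum`).  Elementary; no definition and no named fact is introduced;
sorry-free. [folklore]
-/

set_option linter.dupNamespace false -- `Summit.<S>.<S>.Theorems…` repeats the summit name (D-0017 layout)

namespace Summit.HubbardSuperconductivity.HubbardSuperconductivity.Theorems.FSUnfolding

open scoped BigOperators ComplexConjugate
open Literature.MathematicalPhysics.QuantumFieldTheory Literature.Probability.LatticeModels
open Summit.HubbardSuperconductivity.BirComplexStableXYNegative

/-- **The window character is smooth**: `φ ↦ exp(i·Σ_w n_w φ_w)` is `C^N` on `W r → ℝ` (it is `Complex.exp` of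
`i` times the real-linear form `φ ↦ Σ_w n_w φ_w`, cast into `ℂ`). [folklore] -/
theorem hsc_genF_char_contDiff {r : ℕ} (n : Freq r) (N : ℕ) :
    ContDiff ℝ N (fun φ : W r → ℝ => Complex.exp (Complex.I * ((∑ w, (n w : ℝ) * φ w : ℝ) : ℂ))) := by
  have hlin : ContDiff ℝ N (fun φ : W r → ℝ => ∑ w, (n w : ℝ) * φ w) :=
    ContDiff.sum fun w _ => contDiff_const.mul (contDiff_apply ℝ ℝ w)
  have hcast : ContDiff ℝ N (fun φ : W r → ℝ => ((∑ w, (n w : ℝ) * φ w : ℝ) : ℂ)) :=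
    Complex.ofRealCLM.contDiff.comp hlin
  exact (contDiff_const.mul hcast).cexp

/-- **`T_φ` bound of a finite character sum.**  Given the character bound `‖χ_n‖_{T_φ(𝔥),u} ≤ e^{𝔥|n|₁}` and
`0 ≤ 𝔥 ≤ 1`, for every coefficient function `c` and every finset `s` of frequencies:
`‖Σ_{n∈s} c_n χ_n‖_{T_φ(𝔥),u} ≤ Σ_{n∈s} ‖c_n‖ e^{|n|₁}` (triangle inequality, product property with the constant
`c_n`, monotonicity of `exp`). [folklore] -/
theorem hsc_tphiSeminorm_sum_char_le {r : ℕ} (c : Freq r → ℂ) (N : ℕ) {𝔥 : ℝ} (h𝔥 : 0 ≤ 𝔥) (h𝔥1 : 𝔥 ≤ 1)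
    (hchar : ∀ (n : Freq r) (u : W r → ℝ),
      tphiSeminorm N 𝔥 (fun φ : W r → ℝ => Complex.exp (Complex.I * ((∑ w, (n w : ℝ) * φ w : ℝ) : ℂ))) u ≤
        Real.exp (𝔥 * ∑ w, |(n w : ℝ)|))
    (u : W r → ℝ) (s : Finset (Freq r)) :
    tphiSeminorm N 𝔥
        (fun φ : W r → ℝ => ∑ n ∈ s, c n * Complex.exp (Complex.I * ((∑ w, (n w : ℝ) * φ w : ℝ) : ℂ))) u ≤
      ∑ n ∈ s, ‖c n‖ * Real.exp (∑ w, |(n w : ℝ)|) := by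
  classical
  induction s using Finset.induction_on with
  | empty =>
    simp only [Finset.sum_empty]
    exact (tphiSeminorm_zero N 𝔥 u).le
  | insert a s ha ih =>
    simp only [Finset.sum_insert ha]
    -- smoothness of the two summands
    have hF : ContDiff ℝ N
        (fun φ : W r → ℝ => c a * Complex.exp (Complex.I * ((∑ w, (a w : ℝ) * φ w : ℝ) : ℂ))) :=
      contDiff_const.mul (hsc_genF_char_contDiff a N)
    have hG : ContDiff ℝ N
        (fun φ : W r → ℝ => ∑ n ∈ s, c n * Complex.exp (Complex.I * ((∑ w, (n w : ℝ) * φ w : ℝ) : ℂ))) :=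
      ContDiff.sum fun n _ => contDiff_const.mul (hsc_genF_char_contDiff n N)
    -- the single term
    have hterm : tphiSeminorm N 𝔥
        (fun φ : W r → ℝ => c a * Complex.exp (Complex.I * ((∑ w, (a w : ℝ) * φ w : ℝ) : ℂ))) u ≤
        ‖c a‖ * Real.exp (∑ w, |(a w : ℝ)|) := by
      have hmul := tphiSeminorm_mul_le N h𝔥 (contDiff_const (c := c a)) (hsc_genF_char_contDiff a N) u
      rw [tphiSeminorm_const] at hmul
      refine hmul.trans (mul_le_mul_of_nonneg_left ((hchar a u).trans ?_) (norm_nonneg _))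
      have hS : 0 ≤ ∑ w, |(a w : ℝ)| := Finset.sum_nonneg fun w _ => abs_nonneg _
      exact Real.exp_le_exp.2 (mul_le_of_le_one_left hS h𝔥1)
    exact (tphiSeminorm_add_le N h𝔥 hF hG u).trans (add_le_add hterm ih)

/-- **stub G3 (M): hypothesis (A) is the `T_φ(1)` bound of the window weight.**  Given the character bound G2
(as the hypothesis), for `0 ≤ 𝔥 ≤ 1` and every table `c`: `tphiSeminorm N 𝔥 (genF c) u ≤ normA c` at every `u`
(`genF c = Σ_n c_n·χ_n` over the finite support; `tphiSeminorm_add_le`, `tphiSeminorm_mul_le` with the constant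
`c_n` (`tphiSeminorm_const`), monotonicity of `exp`, and `normA c = Σ_n ‖c_n‖e^{|n|₁}`). [folklore] -/
theorem stub_tphiSeminorm_genF_le :
    (∀ (r : ℕ) (n : Freq r) (N : ℕ) (𝔥 : ℝ), 0 ≤ 𝔥 → ∀ u : W r → ℝ,
      tphiSeminorm N 𝔥 (fun φ : W r → ℝ => Complex.exp (Complex.I * ((∑ w, (n w : ℝ) * φ w : ℝ) : ℂ))) u ≤
        Real.exp (𝔥 * ∑ w, |(n w : ℝ)|)) →
    ∀ (r : ℕ) (c : Table r) (N : ℕ) (𝔥 : ℝ), 0 ≤ 𝔥 → 𝔥 ≤ 1 → ∀ u : W r → ℝ,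
      tphiSeminorm N 𝔥 (fun φ : W r → ℝ => genF c φ) u ≤ normA c := by
  intro hchar r c N 𝔥 h𝔥 h𝔥1 u
  have h := hsc_tphiSeminorm_sum_char_le (⇑c) N h𝔥 h𝔥1 (fun n v => hchar r n N 𝔥 h𝔥 v) u c.support
  simpa only [genF, normA, Finsupp.sum] using h

end Summit.HubbardSuperconductivity.HubbardSuperconductivity.Theorems.FSUnfolding
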